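import Mathlib
import Mathlib.Geometry.Manifold.Instances.Sphere
import Mathlib.Geometry.Manifold.Diffeomorph
import Mathlib.Geometry.Manifold.PoincareConjecture
import Mathlib.Topology.Homotopy.Equiv
import Mathlib.AlgebraicTopology.FundamentalGroupoid.SimplyConnected
import Literature.Topology.FourManifolds.CircleSurgery
import Literature.Topology.FourManifolds.MappingTorus
import Literature.Topology.FourManifolds.ConnectedSum
import HarnessLib.Audit
import HarnessLib

/-!
# CappellShanesonSpheresStandard — CONJECTURE (obligation of SmoothPoincare4/SmoothPoincare4)

Unproven conjecture migrated by the gate from `Literature/Topology/FourManifolds/CappellShaneson.lean` (`Literature.Topology.FourManifolds.CappellShanesonSpheresStandard`): unproven conjectures are obligations of our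
theories, not literature facts (human ruling 2026-08-15). Provenance: GompfAGT2010, Iwaki2025, KimYamada2023. Routes use it as a crux item or via
`--conditional-bridge --conditional-on CappellShanesonSpheresStandard`; a proof goes in the sibling `Theorems/CappellShanesonSpheresStandardHolds.lean` as `theorem CappellShanesonSpheresStandard_holds : CappellShanesonSpheresStandard` so this file stays a conjecture LEAF that Literature/ may import.
-/

namespace Summit.SmoothPoincare4.SmoothPoincare4

open Literature Literature.Topology Literature.Topology.FourManifolds
open scoped Manifold ContDiff Topology
open Set
universe u
local notation "𝔼 " n:arg => EuclideanSpace ℝ (Fin n)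
local notation "𝕊 " n:arg => (Metric.sphere (0 : EuclideanSpace ℝ (Fin (n + 1))) 1)

/-- OPEN CONJECTURE — **spc4.S18**, **the Cappell–Shaneson conjecture** (every Cappell–Shaneson
sphere is standard; general form). The statement that every Cappell–Shaneson homotopy 4-sphere
`X` (a closed smooth 4-manifold obtained from the mapping torus of some `A ∈ SL(3, ℤ)` with
`det (A - 1) = ±1` acting on `T³` by surgery on the section circle, either framing:
`Literature.Topology.FourManifolds.IsCappellShanesonSphere X`) is diffeomorphic to the standard
`S⁴`. POSED, not proved: M. H. Kim, S. Yamada, *Ideal classes and Cappell–Shaneson homotopy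
4-spheres*, Kyungpook Math. J. 63 (2023) 373–411 (arXiv:1707.03860), §1 — "The following
folklore conjecture is a special case of the smooth 4-dimensional Poincaré conjecture and has
remained open for 40 years. Conjecture 1. Every Cappell–Shaneson homotopy 4-sphere is
diffeomorphic to `S⁴`." [cite: KimYamada2023, §1, Conjecture 1 (posed as a folklore conjecture,
"has remained open for 40 years"; not a theorem)]; restated as an open conjecture in K. Iwaki,
Topology Appl. 366 (2025) 109293, §1.1, Conjecture 1.2 — "Every CS sphere is diffeomorphic to
`S⁴`" [cite: Iwaki2025, §1.1, Conjecture 1.2 (posed)]; and left open by R. Gompf, Algebr. Geom.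
Topol. 10 (2010), §1 — "The work is still in progress, and may ultimately show that all
Cappell-Shaneson homotopy spheres are `S⁴`" — and §3, after Corollary 3.5 — "The author does not
presently know whether they cover all Cappell-Shaneson homotopy spheres"
[cite: GompfAGT2010, §1; §3 (remark after Cor. 3.5)]. [status: open] — neither a proof nor a
disproof is in print. Sign convention: Kim–Yamada and Iwaki index the spheres by
*Cappell–Shaneson matrices* `det (A - I) = 1`; the tree's `IsCappellShanesonSphere` also allows
`det (A - 1) = -1`, which gives the same family of manifolds ("Since inverting `A` preserves
`X^ε_φ` but flips the sign of `det (A - I)`, we assume without loss of generality that the sign is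
`+1`", Gompf 2010, §3), so the two formulations pose the same conjecture. What IS known is
recorded below and downstream as named facts / theorems: the family `Aₘ = cappellShanesonMatrix m`
with both framings (Akbulut, Ann. of Math. 171 (2010); Gompf 2010, main theorem:
`nonempty_diffeomorph_sphere_four_of_isCappellShanesonSphereOf`), Gompf's Thm. 3.2 / Cor. 3.5
(`Literature/Barriers/SmoothPoincare4/CappellShanesonFamilyStandard.lean`), the trace range
`-64 ≤ tr A ≤ 69` (Kim–Yamada 2023, Thm. B:
`kimYamada2023_nonempty_diffeomorph_sphere_four_of_trace_mem_Icc`), and that the conjecture is a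
special case of SPC4 (`CappellShanesonSpheresStandard.of_nonemptyDiffeomorphSphere_four`, proved).
Registered here as an OPEN statement (CONVENTIONS §4: an open conjecture is a
`def … : Prop`, never asserted), not as named-fact debt: no `CappellShanesonSpheresStandard_holds`
is to be expected, and users keep the explicit hypothesis `(h : CappellShanesonSpheresStandard)`
or target it as a route item. The name is kept (no `…Conjecture` suffix) because
`Literature.Barriers.SmoothPoincare4.CappellShanesonFamilyStandard`
(`exoticCappellShanesonSphere_univ_iff`), `CappellShanesonHomotopySphereHolds.lean`
(`CappellShanesonSpheresStandard.of_smoothPoincareFour`) and the SPC4 theses `CsArithmeticWalk`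
(assembly target) and `GluckLasagna` use it. -/
@[conjecture] def CappellShanesonSpheresStandard : Prop :=
  ∀ (X : Type) [TopologicalSpace X] [T2Space X] [SecondCountableTopology X]
    [ChartedSpace (𝔼 4) X] [IsManifold (𝓡 4) ∞ X] [CompactSpace X],
    IsCappellShanesonSphere X → Nonempty (X ≃ₘ⟮𝓡 4, 𝓡 4⟯ ↥(𝕊 4))

/-! ### The standard family `Aₘ` (known theorems) -/

end Summit.SmoothPoincare4.SmoothPoincare4
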